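import Summits.Langlands.Langlands.Theses.EisensteinGelfandKirillov

/-!
# Line `levelcollapse` for the crux `EisensteinGKBound` (item stmt-Langlands-18272)

Route `route-Langlands-EisensteinGelfandKirillov`, crux decl
`Summit.Langlands.Langlands.Theses.EisensteinGelfandKirillov.EisensteinGKBound` (THE DOOR, rank 2).

STRATEGIST LINE (crux-strategist seat `cstrat-stmt-Langlands-18272-s1`).  The refuter's route
review (REVIEW-R2.md on the item, 2026-08-17T02:48Z) observed that the crux AS TYPED quantifies the
Eisenstein Hecke condition `T_g f = (c₁ v + c₂ v) • f` over EVERY integral `g` whose reduced norm is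
a uniformizer at `v` and a unit elsewhere — the unit part of `g` (in particular its `p`-component)
is unconstrained.  Since `U(0) = Ô^×` normalises every `U(r)` and `T_{γ g} f (x) = T_g f (x γ)` for
`γ ∈ Ô^×`, every Eisenstein-torsion form with ONE non-zero eigenvalue `c₁ v + c₂ v` is right
`Ô^×`-invariant, i.e. of level `U(0)`, and a linearly independent family of such forms has at most
`#(D^× \ D_f^× / Ô^×)` members, uniformly in `r` ("level collapse").  The one non-formal input is a
place `v ∉ S` with `c₁ v + c₂ v ≠ 0`, supplied by the tree's PROVED Chebotarev density theorem
(`absoluteGaloisGroup.frobenius_dense` + `chebotarev_artinRep_holds`: a Frobenius in the open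
neighbourhood `ker χ₁ ∩ ker χ₂` of `1` gives `c₁ v = c₂ v = 1`, sum `2 ≠ 0` as `p ≥ 5`), and the
existence of an admissible `g` at such `v` (Hensel: `exists_integral_sq_sub_mul_sq` splits the
coordinate order at `v ∤ 2ab`, `QuaternionAlgebra.splitEquiv`, `extendOne`).

PROVED here (no `sorry`): `heckeOperator_conj_apply` (Hecke operators vs. the normaliser of the
level), `conj_mem_level` (`Ô^×` normalises the principal congruence levels `U(r)` of the crux),
`admissible_mul` (admissibility is stable under `Ô^×`), the norm-form lemmas, and the composition
`EisensteinGKBound_of`.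
REGISTERED STUBS (sorried, each a genuine lemma over existing declarations):
* `stub_exists_frob_sum_ne_zero`  — Chebotarev-lite: some `v ∉ S` has `c₁ v + c₂ v ≠ 0`  [M];
* `stub_exists_admissible`        — at every `v ∉ S` there is an integral `g ∈ D_f^×` with `nrd g`
                                    a uniformizer at `v` and a unit elsewhere  [L, hardest];
* `stub_card_le_of_integralUnits_invariant` — a `k`-linearly independent family of right
                                    `Ô^×`-invariant forms (any level) has ≤ `#(D^×\D_f^×/Ô^×)`
                                    members  [M].
Honours no `_false_without_` theorem (no Disproof.lean exists for this crux).
-/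

namespace Summit.Langlands.Langlands.Cruxes.EisensteinGKBound.LevelCollapse

open scoped Classical
open NumberField IsDedekindDomain Polynomial
open Literature.NumberTheory.Automorphic Literature.NumberTheory.GaloisRepresentations
open Summit.Langlands.Langlands.Theses.EisensteinGelfandKirillov (EisensteinGKBound)

/-- `ℍ⟮F; a, b⟯ := ℍ[F, a, b]` for `a b : 𝓞 F` (the `D` of the crux). -/
local notation "ℍ⟮" F "; " a ", " b "⟯" =>
  QuaternionAlgebra F (algebraMap (NumberField.RingOfIntegers F) F a) (0 : F)
    (algebraMap (NumberField.RingOfIntegers F) F b)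

/-! ### Registered stubs

Stub statements are written WITHOUT local notation and WITHOUT `let` binders (the crux's
`let x := …; … ∧ let nrd := …; …` admissibility clause is expanded — definitionally equal by ζ), so that
the registered signatures are plain text a prover can restate verbatim. -/

/-- **Stub 1 (Chebotarev-lite; the non-formal input).**  For characters `χ₁ χ₂ : Γ_F → k^×`
(`k` discrete of characteristic `p ≥ 5`) with Frobenius values `c₁ v, c₂ v` off `S`, some place
`v ∉ S` has `c₁ v + c₂ v ≠ 0`.  Intended proof: the tree's proved Chebotarev theorem
(`absoluteGaloisGroup.frobenius_dense chebotarev_artinRep_holds`): the open neighbourhood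
`{σ | χ₁ σ = 1 ∧ χ₂ σ = 1}` of `1` contains an arithmetic Frobenius `σ` at some `v ∉ S`; then
`X - C (cᵢ v) = charpoly (χᵢ σ) = X - 1`, so `c₁ v + c₂ v = 2 ≠ 0`. -/
theorem stub_exists_frob_sum_ne_zero :
    ∀ (F : Type) [Field F] [NumberField F] (p : ℕ) [Fact p.Prime], 5 ≤ p →
    ∀ (k : Type) [Field k] [CharP k p] [TopologicalSpace k] [DiscreteTopology k]
      (S : Finset (HeightOneSpectrum (𝓞 F)))
      (χ₁ χ₂ : FramedGaloisRep F k 1) (c₁ c₂ : HeightOneSpectrum (𝓞 F) → k),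
      (∀ v ∉ S, χ₁.IsUnramifiedAt v ∧ χ₂.IsUnramifiedAt v ∧
        χ₁.HasFrobCharpolyAt v (X - C (c₁ v)) ∧ χ₂.HasFrobCharpolyAt v (X - C (c₂ v))) →
      ∃ v ∉ S, c₁ v + c₂ v ≠ 0 := by
  sorry

/-- **Stub 2 (admissible Hecke elements exist at good places; hardest stub).**  For
`v ∉ S ⊇ {w ∣ 2pab}` there is an integral `g ∈ (𝔸_F^∞ ⊗ ℍ[F,a,b])^×` whose reduced norm (the norm
form of the coordinates) is a uniformizer at `v` and a unit at every other place.  Intended proof: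
`a, b, 2` are `v`-units, so `s² - a t² = b` has an integral solution at `v`
(`exists_integral_sq_sub_mul_sq`, Hensel), whence `ℍ[𝒪_v,a,b] ≃ M₂(𝒪_v)`
(`QuaternionAlgebra.splitEquiv`, `det_splitHom`); take the preimage of `diag(ϖ_v, 1)` and extend
it by `1` (`QuaternionAlgebra.extendOne`, `extendOne_mem`, `extendOne_mul_star`), pulled back along
`adelicEquiv`; invertibility from the same construction for `diag(1, ϖ_v)` (product `ϖ_v`, a unit
of `𝔸_F^∞`). -/
theorem stub_exists_admissible :
    ∀ (F : Type) [Field F] [NumberField F] (p : ℕ) [Fact p.Prime] (a b : 𝓞 F), a ≠ 0 → b ≠ 0 →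
    ∀ (S : Finset (HeightOneSpectrum (𝓞 F))),
      (∀ v : HeightOneSpectrum (𝓞 F), ((2 * p : ℕ) : 𝓞 F) * a * b ∈ v.asIdeal → v ∈ S) →
    ∀ v ∉ S, ∃ g : finiteAdelicUnits F (QuaternionAlgebra F (algebraMap (𝓞 F) F a) (0 : F)
        (algebraMap (𝓞 F) F b)),
      QuaternionAlgebra.adelicEquiv a b ↑g ∈ QuaternionAlgebra.adelicOrder a b ∧
      ∀ w : HeightOneSpectrum (𝓞 F),
        Valued.v ((QuaternionAlgebra.adelicCoords a b ↑g 0 ^ 2 -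
            algebraMap (𝓞 F) (FiniteAdeleRing (𝓞 F) F) a * QuaternionAlgebra.adelicCoords a b ↑g 1 ^ 2 -
            algebraMap (𝓞 F) (FiniteAdeleRing (𝓞 F) F) b * QuaternionAlgebra.adelicCoords a b ↑g 2 ^ 2 +
            algebraMap (𝓞 F) (FiniteAdeleRing (𝓞 F) F) a * algebraMap (𝓞 F) (FiniteAdeleRing (𝓞 F) F) b *
              QuaternionAlgebra.adelicCoords a b ↑g 3 ^ 2) w) =
          if w = v then WithZero.exp (-1) else 1 := by
  sorry

/-- **Stub 3 (the class-number bound at level `Ô^×`).**  There is `C ≥ 0` (namely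
`#(D^× \ D_f^× / Ô^×)`, finite by `QuaternionicForm.finite_doubleQuotient_holds` and
`QuaternionAlgebra.isOpen_integralUnits`, with `IsQuaternionAlgebra` from
`QuaternionAlgebra.isQuaternionAlgebra_holds`) such that every `k`-linearly independent family of
forms of ANY level whose members are right `Ô^×`-invariant has at most `C` members: such forms are
functions on the finite double quotient (every `x` is `d · t · γ`, `d ∈ D^×`, `t` in a finite
transversal, `γ ∈ Ô^×`, cf. `exists_finset_eq_mul_mul_of_finite`), and restriction to the
transversal is an injective linear map into `T → k`. -/
theorem stub_card_le_of_integralUnits_invariant :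
    ∀ (F : Type) [Field F] [NumberField F] (a b : 𝓞 F), a ≠ 0 → b ≠ 0 →
    ∀ (k : Type) [Field k],
      ∃ C : ℝ, 0 ≤ C ∧ ∀ (U : Subgroup (finiteAdelicUnits F (QuaternionAlgebra F (algebraMap (𝓞 F) F a)
          (0 : F) (algebraMap (𝓞 F) F b)))) (ι : Type) [Fintype ι]
        (f : ι → QuaternionicForm (QuaternionAlgebra F (algebraMap (𝓞 F) F a) (0 : F)
          (algebraMap (𝓞 F) F b)) U k), LinearIndependent k f →
        (∀ i, ∀ γ ∈ QuaternionAlgebra.integralUnits a b, ∀ x, f i (x * γ) = f i x) →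
        (Fintype.card ι : ℝ) ≤ C := by
  sorry

/-! ### Proved: Hecke operators and the normaliser of the level -/

/-- If `γ` normalises the level `U`, then `T_{γ g} f (x) = T_g f (x γ)` for every form `f` of
level `U`: `U γ g U = γ (U g U)`, so left multiplication by `γ` is a bijection from the `U`-orbit of
`g U` onto that of `γ g U`, and `f (x (γ y).out) = f (x γ y.out)` by right `U`-invariance. -/
theorem heckeOperator_conj_apply {K : Type} [Field K] [NumberField K] {D : Type} [Ring D]
    [Algebra K D] {U : Subgroup (finiteAdelicUnits K D)} {R : Type} [AddCommGroup R]
    (S : Type) [Semiring S] [Module S R]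
    [IsHeckeTriple (⊤ : Submonoid (finiteAdelicUnits K D)) U U]
    (γ g : finiteAdelicUnits K D) (hγ : ∀ u, u ∈ U ↔ γ * u * γ⁻¹ ∈ U)
    (f : QuaternionicForm D U R) (x : finiteAdelicUnits K D) :
    QuaternionicForm.heckeOperator S (γ * g) f x =
      QuaternionicForm.heckeOperator S g f (x * γ) := by
  rw [QuaternionicForm.heckeOperator_apply, QuaternionicForm.heckeOperator_apply]
  symm
  refine finsum_mem_eq_of_bijOn (fun y => γ • y) ⟨?_, ?_, ?_⟩ ?_
  · rintro y ⟨u, rfl⟩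
    refine ⟨⟨γ * u * γ⁻¹, (hγ u).1 u.2⟩, ?_⟩
    change ((γ * u * γ⁻¹ * (γ * g) : finiteAdelicUnits K D) : finiteAdelicUnits K D ⧸ U) =
      ((γ * (u * g) : finiteAdelicUnits K D) : finiteAdelicUnits K D ⧸ U)
    congr 1
    group
  · intro y _ z _ h
    exact smul_left_cancel γ h
  · rintro z ⟨u, rfl⟩
    have hu : γ⁻¹ * u * γ ∈ U := by
      rw [hγ]
      simpa [mul_assoc] using u.2
    refine ⟨(⟨γ⁻¹ * u * γ, hu⟩ : U) • (g : finiteAdelicUnits K D ⧸ U),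
      MulAction.mem_orbit _ _, ?_⟩
    change ((γ * (γ⁻¹ * u * γ * g) : finiteAdelicUnits K D) : finiteAdelicUnits K D ⧸ U) =
      ((u * (γ * g) : finiteAdelicUnits K D) : finiteAdelicUnits K D ⧸ U)
    congr 1
    group
  · intro y _
    obtain ⟨h, H⟩ := QuotientGroup.mk_out_eq_mul U (γ * y.out)
    have e : γ • y = ((γ * y.out : finiteAdelicUnits K D) : finiteAdelicUnits K D ⧸ U) := by
      rw [← MulAction.Quotient.coe_smul_out]; rfl
    show f (x * γ * y.out) = f (x * (γ • y).out)
    rw [e, H, ← mul_assoc, ← mul_assoc, f.right_invt h.2]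

/-! ### Proved: the norm form, `Ô^×`-stability of admissibility, normality of `U(r)` -/

/-- The norm form `x₀² - α x₁² - β x₂² + α β x₃²` of `ℍ[R, α, 0, β]` (proof-internal abbreviation;
it does not occur in any stub statement). -/
def normForm {R : Type*} [CommRing R] (α β : R) (q : QuaternionAlgebra R α 0 β) : R :=
  q.re ^ 2 - α * q.imI ^ 2 - β * q.imJ ^ 2 + α * β * q.imK ^ 2

/-- Multiplicativity of the norm form (a polynomial identity). -/
theorem normForm_mul {R : Type*} [CommRing R] (α β : R) (q₁ q₂ : QuaternionAlgebra R α 0 β) :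
    normForm α β (q₁ * q₂) = normForm α β q₁ * normForm α β q₂ := by
  simp only [normForm, QuaternionAlgebra.re_mul, QuaternionAlgebra.imI_mul,
    QuaternionAlgebra.imJ_mul, QuaternionAlgebra.imK_mul]
  ring

/-- `normForm 1 = 1`. -/
theorem normForm_one {R : Type*} [CommRing R] (α β : R) :
    normForm α β (1 : QuaternionAlgebra R α 0 β) = 1 := by
  simp [normForm]

section Adelic

variable {F : Type} [Field F] [NumberField F] (a b : 𝓞 F)

/-- The coordinate expression of the crux is the norm form of `Φ z` (`Φ = adelicEquiv a b`). -/
theorem coords_normForm (z : ScalarExtension F (FiniteAdeleRing (𝓞 F) F) ℍ⟮F; a, b⟯) :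
    QuaternionAlgebra.adelicCoords a b z 0 ^ 2 -
        algebraMap (𝓞 F) (FiniteAdeleRing (𝓞 F) F) a * QuaternionAlgebra.adelicCoords a b z 1 ^ 2 -
        algebraMap (𝓞 F) (FiniteAdeleRing (𝓞 F) F) b * QuaternionAlgebra.adelicCoords a b z 2 ^ 2 +
        algebraMap (𝓞 F) (FiniteAdeleRing (𝓞 F) F) a *
          algebraMap (𝓞 F) (FiniteAdeleRing (𝓞 F) F) b * QuaternionAlgebra.adelicCoords a b z 3 ^ 2 =
      normForm (algebraMap (𝓞 F) (FiniteAdeleRing (𝓞 F) F) a)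
        (algebraMap (𝓞 F) (FiniteAdeleRing (𝓞 F) F) b) (QuaternionAlgebra.adelicEquiv a b z) := by
  simp [QuaternionAlgebra.adelicCoords_apply, normForm]

/-- The norm form of an element of `Ô` is an integral finite adele. -/
theorem normForm_mem_of_mem
    {q : QuaternionAlgebra (FiniteAdeleRing (𝓞 F) F) (algebraMap (𝓞 F) (FiniteAdeleRing (𝓞 F) F) a)
      (0 : FiniteAdeleRing (𝓞 F) F) (algebraMap (𝓞 F) (FiniteAdeleRing (𝓞 F) F) b)}
    (hq : q ∈ QuaternionAlgebra.adelicOrder a b) :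
    normForm (algebraMap (𝓞 F) (FiniteAdeleRing (𝓞 F) F) a)
      (algebraMap (𝓞 F) (FiniteAdeleRing (𝓞 F) F) b) q ∈ integralFiniteAdeles F := by
  obtain ⟨h0, h1, h2, h3⟩ := (QuaternionAlgebra.mem_adelicOrder_iff a b).1 hq
  have ha := algebraMap_integers_mem_integralFiniteAdeles F a
  have hb := algebraMap_integers_mem_integralFiniteAdeles F b
  unfold normForm
  exact add_mem (sub_mem (sub_mem (pow_mem h0 2) (mul_mem ha (pow_mem h1 2)))
    (mul_mem hb (pow_mem h2 2))) (mul_mem (mul_mem ha hb) (pow_mem h3 2))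

/-- Units of `Ô` have unit norm at every finite place. -/
theorem valued_normForm_eq_one_of_mem_integralUnits {γ : finiteAdelicUnits F ℍ⟮F; a, b⟯}
    (hγ : γ ∈ QuaternionAlgebra.integralUnits a b) (w : HeightOneSpectrum (𝓞 F)) :
    Valued.v (normForm (algebraMap (𝓞 F) (FiniteAdeleRing (𝓞 F) F) a)
      (algebraMap (𝓞 F) (FiniteAdeleRing (𝓞 F) F) b) (QuaternionAlgebra.adelicEquiv a b ↑γ) w) = 1 := by
  rw [QuaternionAlgebra.mem_integralUnits_iff] at hγ
  set α := algebraMap (𝓞 F) (FiniteAdeleRing (𝓞 F) F) a with hα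
  set β := algebraMap (𝓞 F) (FiniteAdeleRing (𝓞 F) F) b with hβ
  have hprod : normForm α β (QuaternionAlgebra.adelicEquiv a b ↑γ) *
      normForm α β (QuaternionAlgebra.adelicEquiv a b ↑γ⁻¹) = 1 := by
    rw [← normForm_mul, ← map_mul, Units.mul_inv, map_one, normForm_one]
  have hle : ∀ t ∈ integralFiniteAdeles F, Valued.v (t w) ≤ 1 := fun t ht =>
    (HeightOneSpectrum.mem_adicCompletionIntegers _ _ _).1 ((mem_integralFiniteAdeles_iff).1 ht w)
  have h1 := hle _ (normForm_mem_of_mem a b hγ.1)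
  have h2 := hle _ (normForm_mem_of_mem a b hγ.2)
  have h12 : Valued.v (normForm α β (QuaternionAlgebra.adelicEquiv a b ↑γ) w) *
      Valued.v (normForm α β (QuaternionAlgebra.adelicEquiv a b ↑γ⁻¹) w) = 1 := by
    rw [← map_mul]
    have e : (normForm α β (QuaternionAlgebra.adelicEquiv a b ↑γ) *
        normForm α β (QuaternionAlgebra.adelicEquiv a b ↑γ⁻¹)) w =
        (1 : FiniteAdeleRing (𝓞 F) F) w := by
      rw [hprod]
    rw [show ∀ s t : FiniteAdeleRing (𝓞 F) F, s w * t w = (s * t) w from fun _ _ => rfl, e]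
    exact map_one _
  refine le_antisymm h1 ?_
  calc (1 : WithZero (Multiplicative ℤ))
        = _ := h12.symm
    _ ≤ Valued.v (normForm α β (QuaternionAlgebra.adelicEquiv a b ↑γ) w) * 1 :=
          mul_le_mul_right h2 _
    _ = _ := mul_one _

/-- **Admissibility is stable under `Ô^×`** (formerly stub 5, now proved): if `g` is integral with
reduced norm a uniformizer at `v` and a unit elsewhere, so is `γ g` for `γ ∈ Ô^×`. -/
theorem admissible_mul (v : HeightOneSpectrum (𝓞 F)) (γ g : finiteAdelicUnits F ℍ⟮F; a, b⟯)
    (hγ : γ ∈ QuaternionAlgebra.integralUnits a b)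
    (hg : (let x := QuaternionAlgebra.adelicCoords a b ↑g
       QuaternionAlgebra.adelicEquiv a b ↑g ∈ QuaternionAlgebra.adelicOrder a b ∧
       let nrd : FiniteAdeleRing (𝓞 F) F :=
         x 0 ^ 2 - algebraMap _ _ a * x 1 ^ 2 - algebraMap _ _ b * x 2 ^ 2 +
           algebraMap _ _ a * algebraMap _ _ b * x 3 ^ 2
       ∀ w : HeightOneSpectrum (𝓞 F),
         Valued.v (nrd w) = if w = v then WithZero.exp (-1) else 1)) :
    (let x := QuaternionAlgebra.adelicCoords a b ↑(γ * g)
     QuaternionAlgebra.adelicEquiv a b ↑(γ * g) ∈ QuaternionAlgebra.adelicOrder a b ∧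
     let nrd : FiniteAdeleRing (𝓞 F) F :=
       x 0 ^ 2 - algebraMap _ _ a * x 1 ^ 2 - algebraMap _ _ b * x 2 ^ 2 +
         algebraMap _ _ a * algebraMap _ _ b * x 3 ^ 2
     ∀ w : HeightOneSpectrum (𝓞 F),
       Valued.v (nrd w) = if w = v then WithZero.exp (-1) else 1) := by
  dsimp only at hg ⊢
  obtain ⟨hg1, hg2⟩ := hg
  have hγ' := (QuaternionAlgebra.mem_integralUnits_iff a b).1 hγ
  refine ⟨?_, ?_⟩
  · rw [Units.val_mul, map_mul]
    exact Subring.mul_mem _ hγ'.1 hg1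
  · intro w
    have hw := hg2 w
    rw [coords_normForm] at hw ⊢
    rw [Units.val_mul, map_mul, normForm_mul,
      show ∀ s t : FiniteAdeleRing (𝓞 F) F, (s * t) w = s w * t w from fun _ _ => rfl, map_mul,
      hw, valued_normForm_eq_one_of_mem_integralUnits a b hγ w, one_mul]

/-- **`Ô^×` normalises the principal congruence levels** (formerly stub 4, now proved): with `U(r)`
characterised as in the crux (`u ∈ Ô^×` and every coordinate of `u - 1` in `p^r 𝒪̂_F`),
`γ u γ⁻¹ ∈ U(r)` for `γ ∈ Ô^×`, `u ∈ U(r)`. -/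
theorem conj_mem_level (p : ℕ) (U : ℕ → Subgroup (finiteAdelicUnits F ℍ⟮F; a, b⟯))
    (hU : ∀ r u, u ∈ U r ↔ (u ∈ QuaternionAlgebra.integralUnits a b ∧ ∀ i : Fin 4,
        ∃ y ∈ integralFiniteAdeles F,
          QuaternionAlgebra.adelicCoords a b (↑u - 1) i = ↑(p ^ r) * y))
    (r : ℕ) {γ : finiteAdelicUnits F ℍ⟮F; a, b⟯} (hγ : γ ∈ QuaternionAlgebra.integralUnits a b)
    {u : finiteAdelicUnits F ℍ⟮F; a, b⟯} (hu : u ∈ U r) : γ * u * γ⁻¹ ∈ U r := by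
  rw [hU] at hu ⊢
  obtain ⟨hu0, hu1⟩ := hu
  have hγ' := (QuaternionAlgebra.mem_integralUnits_iff a b).1 hγ
  refine ⟨Subgroup.mul_mem _ (Subgroup.mul_mem _ hγ hu0) (Subgroup.inv_mem _ hγ), ?_⟩
  choose y hy hcoord using hu1
  have h0 := hcoord 0
  have h1 := hcoord 1
  have h2 := hcoord 2
  have h3 := hcoord 3
  simp only [QuaternionAlgebra.adelicCoords_apply, Matrix.cons_val_zero, Matrix.cons_val_one,
    Matrix.cons_val] at h0 h1 h2 h3
  -- the quaternion with coordinates `y`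
  set Y : QuaternionAlgebra (FiniteAdeleRing (𝓞 F) F) (algebraMap (𝓞 F) (FiniteAdeleRing (𝓞 F) F) a)
      (0 : FiniteAdeleRing (𝓞 F) F) (algebraMap (𝓞 F) (FiniteAdeleRing (𝓞 F) F) b) :=
    ⟨y 0, y 1, y 2, y 3⟩ with hYdef
  have hY : Y ∈ QuaternionAlgebra.adelicOrder a b :=
    (QuaternionAlgebra.mem_adelicOrder_iff a b).2 ⟨hy 0, hy 1, hy 2, hy 3⟩
  have hΦu : QuaternionAlgebra.adelicEquiv a b (↑u - 1) =
      ((p ^ r : ℕ) : FiniteAdeleRing (𝓞 F) F) • Y :=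
    QuaternionAlgebra.ext h0 h1 h2 h3
  set Z := QuaternionAlgebra.adelicEquiv a b ↑γ * Y * QuaternionAlgebra.adelicEquiv a b ↑γ⁻¹
    with hZdef
  have hZ : Z ∈ QuaternionAlgebra.adelicOrder a b :=
    Subring.mul_mem _ (Subring.mul_mem _ hγ'.1 hY) hγ'.2
  have e : ((↑(γ * u * γ⁻¹) : ScalarExtension F (FiniteAdeleRing (𝓞 F) F) ℍ⟮F; a, b⟯) - 1) =
      (↑γ : ScalarExtension F (FiniteAdeleRing (𝓞 F) F) ℍ⟮F; a, b⟯) * (↑u - 1) * ↑γ⁻¹ := by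
    rw [mul_sub, sub_mul, mul_one, Units.mul_inv, Units.val_mul, Units.val_mul]
  have hΦ : QuaternionAlgebra.adelicEquiv a b
      ((↑(γ * u * γ⁻¹) : ScalarExtension F (FiniteAdeleRing (𝓞 F) F) ℍ⟮F; a, b⟯) - 1) =
      ((p ^ r : ℕ) : FiniteAdeleRing (𝓞 F) F) • Z := by
    rw [e, map_mul, map_mul, hΦu, mul_smul_comm, smul_mul_assoc]
  obtain ⟨hz0, hz1, hz2, hz3⟩ := (QuaternionAlgebra.mem_adelicOrder_iff a b).1 hZ
  intro i
  refine ⟨QuaternionAlgebra.adelicCoords a b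
      ((QuaternionAlgebra.adelicEquiv a b).symm Z) i, ?_, ?_⟩
  · rw [QuaternionAlgebra.adelicCoords_apply, AlgEquiv.apply_symm_apply]
    fin_cases i
    · exact hz0
    · exact hz1
    · exact hz2
    · exact hz3
  · rw [QuaternionAlgebra.adelicCoords_apply, QuaternionAlgebra.adelicCoords_apply, hΦ,
      AlgEquiv.apply_symm_apply]
    fin_cases i <;> rfl

/-- Iff form of `conj_mem_level`, the shape consumed by `heckeOperator_conj_apply`. -/
theorem mem_level_iff_conj_mem (p : ℕ) (U : ℕ → Subgroup (finiteAdelicUnits F ℍ⟮F; a, b⟯))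
    (hU : ∀ r u, u ∈ U r ↔ (u ∈ QuaternionAlgebra.integralUnits a b ∧ ∀ i : Fin 4,
        ∃ y ∈ integralFiniteAdeles F,
          QuaternionAlgebra.adelicCoords a b (↑u - 1) i = ↑(p ^ r) * y))
    (r : ℕ) {γ : finiteAdelicUnits F ℍ⟮F; a, b⟯} (hγ : γ ∈ QuaternionAlgebra.integralUnits a b)
    (u : finiteAdelicUnits F ℍ⟮F; a, b⟯) : u ∈ U r ↔ γ * u * γ⁻¹ ∈ U r := by
  refine ⟨conj_mem_level a b p U hU r hγ, fun h => ?_⟩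
  have := conj_mem_level a b p U hU r (Subgroup.inv_mem _ hγ) h
  simpa [mul_assoc] using this

end Adelic

/-! ### The composition (kernel-checked, no `sorry`) -/

/-- **Level collapse (the registered composition).**  The crux BY NAME from the three registered
stubs BY NAME (`stub_exists_frob_sum_ne_zero`, `stub_exists_admissible`,
`stub_card_le_of_integralUnits_invariant`), with `C = #(D^× \ D_f^× / Ô^×)` (independent of `r`);
this declaration contains no `sorry` of its own (its only non-standard axiom is the stubs'
`sorryAx`). -/
theorem EisensteinGKBound_of : EisensteinGKBound := by
  have h1 := stub_exists_frob_sum_ne_zero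
  have h2 := stub_exists_admissible
  have h6 := stub_card_le_of_integralUnits_invariant
  intro F _ _ hF p _ hp hdisc a b ha hb D hdef hsplit k _ _ _ _ S hS χ₁ χ₂ c₁ c₂ hχ hdist U _ hU
  obtain ⟨C, hC0, hC⟩ := h6 F a b ha hb k
  refine ⟨C, ?_⟩
  intro r ι _ f hli hhecke
  -- a place `v ∉ S` with non-zero Eisenstein eigenvalue, and an admissible Hecke element at `v`
  obtain ⟨v, hvS, hv⟩ := h1 F p hp k S χ₁ χ₂ c₁ c₂ hχ
  obtain ⟨g, hg⟩ := h2 F p a b ha hb S hS v hvS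
  -- level collapse: every member of the family is right `Ô^×`-invariant
  have hinv : ∀ i, ∀ γ ∈ QuaternionAlgebra.integralUnits a b, ∀ x, f i (x * γ) = f i x := by
    intro i γ hγ x
    have e1 : QuaternionicForm.heckeOperator k g (f i) = (c₁ v + c₂ v) • f i :=
      hhecke i v hvS g hg
    have e2 : QuaternionicForm.heckeOperator k (γ * g) (f i) = (c₁ v + c₂ v) • f i :=
      hhecke i v hvS (γ * g) (admissible_mul a b v γ g hγ hg)
    have e3 : QuaternionicForm.heckeOperator k (γ * g) (f i) x =
        QuaternionicForm.heckeOperator k g (f i) (x * γ) :=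
      heckeOperator_conj_apply k γ g (mem_level_iff_conj_mem a b p U hU r hγ) (f i) x
    rw [e1, e2, QuaternionicForm.coe_smul, Pi.smul_apply, Pi.smul_apply, smul_eq_mul,
      smul_eq_mul] at e3
    exact (mul_right_injective₀ hv e3).symm
  have hcard : (Fintype.card ι : ℝ) ≤ C := hC (U r) ι f hli hinv
  have h1p : (1 : ℝ) ≤ (p : ℝ) := by exact_mod_cast (Fact.out : p.Prime).one_le
  exact hcard.trans (le_mul_of_one_le_right hC0 (one_le_pow₀ h1p))

end Summit.Langlands.Langlands.Cruxes.EisensteinGKBound.LevelCollapse
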